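import Summits.AtomisticToContinuum.BoseEinsteinCondensation.Theses.BECSwapNoCatastrophe
import Literature.MathematicalPhysics.QuantumManyBody.PeriodicBoseGasTagged
import Literature.MathematicalPhysics.QuantumManyBody.DiluteBoseGasUpperBoundLocalization
import Literature.MathematicalPhysics.QuantumManyBody.GroundStateDirichletForm
import HarnessLib

/-!
# Crux `TorusHalfSwapOverlap` (stmt-AtomisticToContinuum-14393), line `birth`, stub `stub_productUpper`

Route `BECSwapNoCatastrophe` (sub-problem `BoseEinsteinCondensation`). Fixed-`n` stub: for a periodic trial state `Ψ`, the product `Ψ ⊗ Ψ` is absolutely admissible on `cell²` and its uncoupled two-copy energy is at most `2 · periodicEnergy v Ψ` (product rule + Tonelli).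

This file proves the REGISTERED stub signature verbatim (tree vocabulary, the two-copy objects inlined as
`let`s exactly as in the route decls), under the registered name, in the line's namespace; it cannot import
the `Cruxes/` skeleton, which reads it back definitionally.

Proof: `Ψ ⊗ Ψ : (X, Y) ↦ Ψ X · Ψ Y` is `C¹` (product of `C¹` functions of the two
projections), `Lℤ³`-periodic in every particle of either copy (`Ψ.periodic` on the touched
factor), and normalised on `cellN ×ˢ cellN` because the restricted Lebesgue measure on the
two-copy cell is the product of the restricted one-copy measures (`Measure.prod_restrict`) and
`∫∫ |Ψ X|²|Ψ Y|² = (∫|Ψ|²)² = 1` (Tonelli, `lintegral_prod_mul`). For the energy, the slices of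
`Ψ ⊗ Ψ` are constant multiples of `Ψ`, so by the product rule
`|∇_X (Ψ X Ψ Y)|² = |Ψ Y|² |∇Ψ(X)|²` (and symmetrically in `Y`); hence the two-copy energy
density is `e(X)|Ψ Y|² + |Ψ X|² e(Y)` with the one-copy density `e = |∇Ψ|² + V^per |Ψ|²`, whose
integral over the two-copy cell is `E·1 + 1·E = 2 · periodicEnergy v Ψ` (Tonelli again); we
record `≤`. Measurability of `|∇Ψ|²`, `V^per`, `|Ψ|²` (needed by Tonelli) is the tree's
(`measurable_kineticDensity`, `measurable_periodicInteraction`, `measurable_normSq` of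
`LiebYngvasonCellMethod.lean` / `DiluteBoseGasUpperBoundLocalization.lean`), and so is the
constant-factor product rule `kineticDensity (c F) = |c|² kineticDensity F`
(`kineticDensity_const_mul_complex` of `GroundStateDirichletForm.lean`).
-/

noncomputable section

open MeasureTheory Filter
open scoped ENNReal NNReal BigOperators ComplexConjugate

namespace Summit.AtomisticToContinuum.BoseEinsteinCondensation.Cruxes.TorusHalfSwapOverlap.Birth

open Literature.MathematicalPhysics.QuantumManyBody.BoseGas
open Summit.AtomisticToContinuum.BoseEinsteinCondensation.Theses.BECSwapNoCatastrophe (TorusSwapPathRigidity)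

/-! ### Helper lemmas (keep them `private` or inside `namespace ProductUpper … end ProductUpper`) -/

namespace ProductUpper

variable {N : ℕ} {L : ℝ}

/-- The one-copy energy density `|∇Ψ|² + V^per |Ψ|²` is measurable. [folklore] -/
theorem measurable_energyDensity {v : ℝ → ℝ≥0∞} (hv : Measurable v)
    (Ψ : PeriodicTrialState N L) :
    Measurable fun X : Config N =>
      kineticDensity Ψ.ψ X + periodicInteraction v L X * (‖Ψ.ψ X‖₊ : ℝ≥0∞) ^ 2 :=
  (measurable_kineticDensity Ψ.contDiff).add
    ((measurable_periodicInteraction hv L).mul (measurable_normSq Ψ.contDiff.continuous))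

/-- **Tonelli for a cross sum.** `∫∫ (e₁(x) ρ₂(y) + ρ₁(x) e₂(y)) = (∫e₁)(∫ρ₂) + (∫ρ₁)(∫e₂)` for
measurable `ℝ≥0∞`-valued functions on a product of s-finite measure spaces. [folklore] -/
theorem lintegral_prod_cross {α β : Type*} [MeasurableSpace α] [MeasurableSpace β]
    (μ : Measure α) (ν : Measure β) [SFinite μ] [SFinite ν] {e₁ ρ₁ : α → ℝ≥0∞} {ρ₂ e₂ : β → ℝ≥0∞}
    (he₁ : Measurable e₁) (hρ₁ : Measurable ρ₁) (hρ₂ : Measurable ρ₂) (he₂ : Measurable e₂) :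
    ∫⁻ z, e₁ z.1 * ρ₂ z.2 + ρ₁ z.1 * e₂ z.2 ∂μ.prod ν =
      (∫⁻ x, e₁ x ∂μ) * (∫⁻ y, ρ₂ y ∂ν) + (∫⁻ x, ρ₁ x ∂μ) * ∫⁻ y, e₂ y ∂ν := by
  have hm : Measurable fun z : α × β => e₁ z.1 * ρ₂ z.2 :=
    (he₁.comp measurable_fst).mul (hρ₂.comp measurable_snd)
  rw [lintegral_add_left hm, lintegral_prod_mul he₁.aemeasurable hρ₂.aemeasurable,
    lintegral_prod_mul hρ₁.aemeasurable he₂.aemeasurable]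

/-- `Ψ ⊗ Ψ` is `C¹`. [folklore] -/
theorem contDiff_prod (Ψ : PeriodicTrialState N L) :
    ContDiff ℝ 1 fun Z : Config N × Config N => Ψ.ψ Z.1 * Ψ.ψ Z.2 :=
  (Ψ.contDiff.comp contDiff_fst).mul (Ψ.contDiff.comp contDiff_snd)

/-- `Ψ ⊗ Ψ` is `Lℤ³`-periodic in every particle of either copy. [folklore] -/
theorem periodic_prod (Ψ : PeriodicTrialState N L) (Z : Config N × Config N) (i : Fin N)
    (k : Fin 3) :
    Ψ.ψ (Z.1 + Pi.single i (EuclideanSpace.single k L)) * Ψ.ψ Z.2 = Ψ.ψ Z.1 * Ψ.ψ Z.2 ∧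
      Ψ.ψ Z.1 * Ψ.ψ (Z.2 + Pi.single i (EuclideanSpace.single k L)) = Ψ.ψ Z.1 * Ψ.ψ Z.2 := by
  rw [Ψ.periodic, Ψ.periodic]
  exact ⟨rfl, rfl⟩

/-- `Ψ ⊗ Ψ` is normalised on the two-copy cell: `∫_{cell²} |Ψ X|²|Ψ Y|² = 1`. [folklore] -/
theorem lintegral_normSq_prod (Ψ : PeriodicTrialState N L) :
    ∫⁻ Z in cellN N L ×ˢ cellN N L, (‖Ψ.ψ Z.1 * Ψ.ψ Z.2‖₊ : ℝ≥0∞) ^ 2 = 1 := by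
  have hm := measurable_normSq Ψ.contDiff.continuous
  rw [Measure.volume_eq_prod, ← Measure.prod_restrict]
  simp_rw [nnnorm_mul, ENNReal.coe_mul, mul_pow]
  rw [lintegral_prod_mul hm.aemeasurable hm.aemeasurable, Ψ.norm_eq, one_mul]

/-- Product rule, pointwise: the uncoupled two-copy energy density of `Ψ ⊗ Ψ` at `(X, Y)` is
`e(X) |Ψ Y|² + |Ψ X|² e(Y)` with `e = |∇Ψ|² + V^per|Ψ|²`. [folklore] -/
theorem energyDensity_prod (v : ℝ → ℝ≥0∞) (Ψ : PeriodicTrialState N L) (Z : Config N × Config N) :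
    kineticDensity (fun X => Ψ.ψ X * Ψ.ψ Z.2) Z.1 + kineticDensity (fun Y => Ψ.ψ Z.1 * Ψ.ψ Y) Z.2 +
        (periodicInteraction v L Z.1 + periodicInteraction v L Z.2) *
          (‖Ψ.ψ Z.1 * Ψ.ψ Z.2‖₊ : ℝ≥0∞) ^ 2 =
      (kineticDensity Ψ.ψ Z.1 + periodicInteraction v L Z.1 * (‖Ψ.ψ Z.1‖₊ : ℝ≥0∞) ^ 2) *
          (‖Ψ.ψ Z.2‖₊ : ℝ≥0∞) ^ 2 +
        (‖Ψ.ψ Z.1‖₊ : ℝ≥0∞) ^ 2 *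
          (kineticDensity Ψ.ψ Z.2 + periodicInteraction v L Z.2 * (‖Ψ.ψ Z.2‖₊ : ℝ≥0∞) ^ 2) := by
  have h1 : kineticDensity (fun X => Ψ.ψ X * Ψ.ψ Z.2) Z.1 =
      (‖Ψ.ψ Z.2‖₊ : ℝ≥0∞) ^ 2 * kineticDensity Ψ.ψ Z.1 := by
    rw [show (fun X => Ψ.ψ X * Ψ.ψ Z.2) = fun X => Ψ.ψ Z.2 * Ψ.ψ X from
      funext fun X => mul_comm _ _]
    exact kineticDensity_const_mul_complex (Ψ.ψ Z.2) Ψ.ψ Z.1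
  have h2 : kineticDensity (fun Y => Ψ.ψ Z.1 * Ψ.ψ Y) Z.2 =
      (‖Ψ.ψ Z.1‖₊ : ℝ≥0∞) ^ 2 * kineticDensity Ψ.ψ Z.2 :=
    kineticDensity_const_mul_complex (Ψ.ψ Z.1) Ψ.ψ Z.2
  rw [h1, h2, nnnorm_mul, ENNReal.coe_mul, mul_pow]
  ring

/-- **`E2(0)(Ψ ⊗ Ψ) = 2 · periodicEnergy v Ψ`**: the uncoupled two-copy energy of the product state
(product rule + Tonelli on `cellN ×ˢ cellN`). [folklore] -/
theorem energy_prod_eq {v : ℝ → ℝ≥0∞} (hv : Measurable v) (Ψ : PeriodicTrialState N L) :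
    ∫⁻ Z in cellN N L ×ˢ cellN N L,
        kineticDensity (fun X => Ψ.ψ X * Ψ.ψ Z.2) Z.1 +
            kineticDensity (fun Y => Ψ.ψ Z.1 * Ψ.ψ Y) Z.2 +
          (periodicInteraction v L Z.1 + periodicInteraction v L Z.2) *
            (‖Ψ.ψ Z.1 * Ψ.ψ Z.2‖₊ : ℝ≥0∞) ^ 2 =
      2 * periodicEnergy v Ψ := by
  have key := lintegral_prod_cross ((volume : Measure (Config N)).restrict (cellN N L))
    ((volume : Measure (Config N)).restrict (cellN N L)) (measurable_energyDensity hv Ψ)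
    (measurable_normSq Ψ.contDiff.continuous) (measurable_normSq Ψ.contDiff.continuous)
    (measurable_energyDensity hv Ψ)
  rw [Ψ.norm_eq, mul_one, one_mul, ← two_mul] at key
  rw [Measure.volume_eq_prod, ← Measure.prod_restrict]
  simp_rw [energyDensity_prod v Ψ]
  exact key

end ProductUpper

/-! ### The registered stub -/

/-- **`Ψ ⊗ Ψ ∈ Adm0` and `E2(0)(Ψ ⊗ Ψ) ≤ 2·periodicEnergy v Ψ`** (`stub_productUpper`, registered signature). [folklore] -/
theorem stub_productUpper :
    ∀ v : ℝ → ℝ≥0∞, IsRepulsiveFiniteRange v → ∀ (n : ℕ) (L : ℝ) (Ψ : PeriodicTrialState (n + 1) L),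
      let C2 : Set (Config (n + 1) × Config (n + 1)) := (cellN (n + 1) L) ×ˢ (cellN (n + 1) L)
      let E2z : (Config (n + 1) × Config (n + 1) → ℂ) → ℝ≥0∞ := fun Θ => ∫⁻ Z in C2,
          kineticDensity (fun X => Θ (X, Z.2)) Z.1 + kineticDensity (fun Y => Θ (Z.1, Y)) Z.2 +
            (periodicInteraction v L Z.1 + periodicInteraction v L Z.2) * (‖Θ Z‖₊ : ENNReal) ^ 2
      let Adm : (Config (n + 1) × Config (n + 1) → ℂ) → Prop := fun Θ => ContDiff ℝ 1 Θ ∧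
          (∀ (Z : Config (n + 1) × Config (n + 1)) (i : Fin (n + 1)) (k : Fin 3),
            Θ (Z.1 + Pi.single i (EuclideanSpace.single k L), Z.2) = Θ Z ∧
              Θ (Z.1, Z.2 + Pi.single i (EuclideanSpace.single k L)) = Θ Z) ∧
          ∫⁻ Z in C2, (‖Θ Z‖₊ : ENNReal) ^ 2 = 1
      Adm (fun Z => Ψ.ψ Z.1 * Ψ.ψ Z.2) ∧ E2z (fun Z => Ψ.ψ Z.1 * Ψ.ψ Z.2) ≤ 2 * periodicEnergy v Ψ := by
  intro v hv n L Ψ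
  exact ⟨⟨ProductUpper.contDiff_prod Ψ, ProductUpper.periodic_prod Ψ,
    ProductUpper.lintegral_normSq_prod Ψ⟩, (ProductUpper.energy_prod_eq hv.1 Ψ).le⟩

end Summit.AtomisticToContinuum.BoseEinsteinCondensation.Cruxes.TorusHalfSwapOverlap.Birth

end
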